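import Literature.Computability.AlgebraicComplexity.BirkhoffShadowProofs

/-!
# `DivisionGap.ShadowBirkhoff` (stmt-ValiantsHypothesis-5069): pencil and polygon counting tools
(negative-knowledge foundations from the standing disprover)

General counting facts used by the sibling files `LoadBearing` (refuted variants of the crux) and
`PathFacesCap` (Gusfield's cap), all built on the "uniquely supported points of a pencil" machinery
of the HY21 Prop. 23 file (`HrubesYehudayoff2021Prop23.extremePoints_subset_um4`, `ncard_um_add_le`,
`permSums_eq_iUnion`):

* growth arithmetic against the crux's threshold `2^{(log₂ n + c)^c}`: `poly_le_qp`,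
  `exp_lt_threshold`, `qp_entries_le`;
* `injOn_um`, `ncard_um_le_ncard_image` — a pencil `c + t·d` supports uniquely at most `|d(X)|`
  points; `ncard_um_finset_sum_le` — **Minkowski sums only add**: `|UM(∑ᵢ Xᵢ)| ≤ 1 + ∑ᵢ |Xᵢ|`;
  `ncard_um_permSums_le_met` — **row-set entropy**: HY21's halving step summed only over the
  half-row-sets actually met by uniquely supported points (`|UM| ≤ |T|·2·(half maximum)`; a witness
  of the crux must run its optimal matchings through super-quasi-polynomially many row-subsets
  `π(C₁)` at some scale, a disproof is a quasi-polynomial bound on that entropy);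
* `ncard_extremePoints_le_of_pencils` (four pencils cover the plane: `|vert| ≤ 4B`),
  `ncard_extremePoints_le_two_mul_values` (`|vert conv S| ≤ 2|x₀(S)| + 2|x₁(S)|`),
  `birkhoffShadowVertexCount_le_values` (the Birkhoff specialisation).

Nothing here asserts or denies a Theses statement; see `LoadBearing`, `PathFacesCap` and
`Cruxes/ShadowBirkhoff/Disproof.lean`.
-/

noncomputable section

open scoped Pointwise

universe u

namespace Summit.ValiantsHypothesis.Theorems.ShadowBirkhoffNegative

open Literature.Computability.AlgebraicComplexity

/-! ## Growth arithmetic -/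

/-- `8·n^{k+1} + 4 ≤ 2^{(log₂ n + (k+2))^{k+2}}` for all `n, k`. [folklore] -/
theorem poly_le_qp (n k : ℕ) : 8 * n ^ (k + 1) + 4 ≤ 2 ^ ((Nat.log 2 n + (k + 2)) ^ (k + 2)) := by
  set L := Nat.log 2 n with hL
  have hn : n < 2 ^ (L + 1) := Nat.lt_pow_succ_log_self (by norm_num) n
  have h1 : n ^ (k + 1) < 2 ^ ((L + 1) * (k + 1)) := by
    calc n ^ (k + 1) < (2 ^ (L + 1)) ^ (k + 1) := Nat.pow_lt_pow_left hn (by omega)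
      _ = 2 ^ ((L + 1) * (k + 1)) := by rw [← pow_mul]
  have hmul : 1 ≤ (L + 1) * (k + 1) := Nat.one_le_iff_ne_zero.mpr (by positivity)
  have h2 : (L + 1) * (k + 1) + 3 ≤ (L + (k + 2)) ^ 2 := by nlinarith [hmul]
  have hexp : (L + 1) * (k + 1) + 3 ≤ (L + (k + 2)) ^ (k + 2) := by
    calc (L + 1) * (k + 1) + 3 ≤ (L + (k + 2)) ^ 2 := h2
      _ = (L + (k + 2)) ^ 2 * 1 := (mul_one _).symm
      _ ≤ (L + (k + 2)) ^ 2 * (L + (k + 2)) ^ k :=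
          Nat.mul_le_mul_left _ (Nat.one_le_pow _ _ (by omega))
      _ = (L + (k + 2)) ^ (k + 2) := by ring
  calc 8 * n ^ (k + 1) + 4 ≤ 8 * 2 ^ ((L + 1) * (k + 1)) := by omega
    _ = 2 ^ ((L + 1) * (k + 1) + 3) := by rw [pow_add]; ring
    _ ≤ 2 ^ ((L + (k + 2)) ^ (k + 2)) := Nat.pow_le_pow_right (by norm_num) hexp

/-- `4·2^{4m} < 2^{(log₂ n + (4m+3))^{4m+3}}` for all `n, m`. [folklore] -/
theorem exp_lt_threshold (n m : ℕ) : 4 * 2 ^ (4 * m) < 2 ^ ((Nat.log 2 n + (4 * m + 3)) ^ (4 * m + 3)) := by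
  have h1 : 4 * 2 ^ (4 * m) < 2 ^ (4 * m + 3) := by
    have hp : 0 < 2 ^ (4 * m) := Nat.two_pow_pos _
    have h8 : (2 : ℕ) ^ 3 = 8 := by norm_num
    rw [pow_add, h8]; omega
  have h2 : 4 * m + 3 ≤ (Nat.log 2 n + (4 * m + 3)) ^ (4 * m + 3) := by
    calc 4 * m + 3 ≤ Nat.log 2 n + (4 * m + 3) := by omega
      _ = (Nat.log 2 n + (4 * m + 3)) ^ 1 := (pow_one _).symm
      _ ≤ (Nat.log 2 n + (4 * m + 3)) ^ (4 * m + 3) :=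
          Nat.pow_le_pow_right (by omega) (by omega)
  exact h1.trans_le (Nat.pow_le_pow_right (by norm_num) h2)

/-- `8·n·2^{(log₂ n)^k} + 4 ≤ 2^{(log₂ n + (k+5))^{k+5}}` for all `n, k`. [folklore] -/
theorem qp_entries_le (n k : ℕ) :
    8 * (n * 2 ^ (Nat.log 2 n ^ k)) + 4 ≤ 2 ^ ((Nat.log 2 n + (k + 5)) ^ (k + 5)) := by
  set L := Nat.log 2 n with hL
  have hn : n < 2 ^ (L + 1) := Nat.lt_pow_succ_log_self (by norm_num) n
  have hM : 1 ≤ 2 ^ (L ^ k) := Nat.one_le_two_pow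
  have h1 : 8 * (n * 2 ^ (L ^ k)) + 4 ≤ 2 ^ (L ^ k + L + 4) := by
    have e : 2 ^ (L ^ k + L + 4) = 16 * (2 ^ L * 2 ^ (L ^ k)) := by
      rw [pow_add, pow_add, show (2 : ℕ) ^ 4 = 16 by norm_num]; ring
    have s2 : (n + 1) * 2 ^ (L ^ k) ≤ (2 * 2 ^ L) * 2 ^ (L ^ k) :=
      Nat.mul_le_mul_right _ (by rw [pow_succ] at hn; omega)
    rw [e]
    calc 8 * (n * 2 ^ (L ^ k)) + 4 ≤ 8 * (n * 2 ^ (L ^ k)) + 8 * 2 ^ (L ^ k) := by omega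
      _ = 8 * ((n + 1) * 2 ^ (L ^ k)) := by ring
      _ ≤ 8 * ((2 * 2 ^ L) * 2 ^ (L ^ k)) := Nat.mul_le_mul_left 8 s2
      _ = 16 * (2 ^ L * 2 ^ (L ^ k)) := by ring
  have h2 : L ^ k + L + 4 ≤ (L + (k + 5)) ^ (k + 5) := by
    have hA : L ^ k ≤ (L + (k + 5)) ^ (k + 1) :=
      (Nat.pow_le_pow_left (Nat.le_add_right L (k + 5)) k).trans
        (Nat.pow_le_pow_right (by omega) (by omega))
    have hB : L + 4 ≤ (L + (k + 5)) ^ (k + 1) := by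
      calc L + 4 ≤ L + (k + 5) := by omega
        _ = (L + (k + 5)) ^ 1 := (pow_one _).symm
        _ ≤ (L + (k + 5)) ^ (k + 1) := Nat.pow_le_pow_right (by omega) (by omega)
    have hC : 2 * (L + (k + 5)) ^ (k + 1) ≤ (L + (k + 5)) ^ (k + 5) := by
      calc 2 * (L + (k + 5)) ^ (k + 1) ≤ (L + (k + 5)) * (L + (k + 5)) ^ (k + 1) :=
            Nat.mul_le_mul_right _ (by omega)
        _ = (L + (k + 5)) ^ (k + 2) := by ring
        _ ≤ (L + (k + 5)) ^ (k + 5) := Nat.pow_le_pow_right (by omega) (by omega)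
    omega
  exact h1.trans (Nat.pow_le_pow_right (by norm_num) h2)

/-! ## Uniquely supported points of a pencil -/

section Pencil

variable {G : Type*} [AddCommGroup G] (c d : G →+ ℝ)

local notation3 (prettyPrint := false) "UM[" c ", " d ", " X "]" =>
  {p | p ∈ X ∧ ∃ t : ℝ, ∀ q ∈ X, q ≠ p → c q + t * d q < c p + t * d p}

/-- Two points uniquely supported by the same pencil `c + t•d` have different `d`-values.
[folklore] -/
theorem injOn_um (X : Set G) : Set.InjOn d UM[c, d, X] := by
  rintro p ⟨hp, t, ht⟩ p' ⟨hp', t', ht'⟩ hd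
  by_contra hne
  have h1 := ht p' hp' (Ne.symm hne)
  have h2 := ht' p hp hne
  simp only [hd] at h1 h2
  linarith

/-- Hence a pencil supports uniquely at most `|d(X)|` points. [folklore] -/
theorem ncard_um_le_ncard_image (X : Set G) (hX : X.Finite) :
    (UM[c, d, X]).ncard ≤ (d '' X).ncard := by
  calc (UM[c, d, X]).ncard = (d '' UM[c, d, X]).ncard := ((injOn_um c d X).ncard_image).symm
    _ ≤ (d '' X).ncard := Set.ncard_le_ncard (Set.image_mono fun p hp => hp.1) (hX.image _)

/-- A pencil supports uniquely at most `|X|` points. [folklore] -/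
theorem ncard_um_le_ncard (X : Set G) (hX : X.Finite) : (UM[c, d, X]).ncard ≤ X.ncard :=
  Set.ncard_le_ncard (fun _ hp => hp.1) hX

/-- Finite Minkowski sums of finite sets are finite. [folklore] -/
theorem finite_finset_sum {ι : Type*} (s : Finset ι) (f : ι → Set G) (hf : ∀ i, (f i).Finite) :
    (∑ i ∈ s, f i).Finite := by
  classical
  induction s using Finset.induction_on with
  | empty => rw [Finset.sum_empty]; exact Set.finite_zero
  | insert a s ha ih => rw [Finset.sum_insert ha]; exact (hf a).add ih

/-- **Minkowski sums only add.** Uniquely supported points are subadditive over finite Minkowski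
sums: `|UM(∑ᵢ Xᵢ)| ≤ 1 + ∑ᵢ |Xᵢ|` (iterating the planar step `ncard_um_add_le` of HY21 Prop. 23).
[cite: HrubesYehudayoff2021, Prop. 23 (proof)] -/
theorem ncard_um_finset_sum_le {ι : Type*} (s : Finset ι) (f : ι → Set G)
    (hf : ∀ i, (f i).Finite) :
    (UM[c, d, ∑ i ∈ s, f i]).ncard ≤ 1 + ∑ i ∈ s, (f i).ncard := by
  classical
  induction s using Finset.induction_on with
  | empty =>
      simp only [Finset.sum_empty, add_zero]
      calc (UM[c, d, (0 : Set G)]).ncard ≤ (0 : Set G).ncard :=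
            ncard_um_le_ncard c d _ Set.finite_zero
        _ = 1 := by rw [← Set.singleton_zero, Set.ncard_singleton]
  | insert a s ha ih =>
      rw [Finset.sum_insert ha, Finset.sum_insert ha]
      calc (UM[c, d, f a + ∑ i ∈ s, f i]).ncard
          ≤ (UM[c, d, f a]).ncard + (UM[c, d, ∑ i ∈ s, f i]).ncard :=
            HrubesYehudayoff2021Prop23.ncard_um_add_le c d _ _ (hf a) (finite_finset_sum s f hf)
        _ ≤ (f a).ncard + (1 + ∑ i ∈ s, (f i).ncard) :=
            add_le_add (ncard_um_le_ncard c d _ (hf a)) ih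
        _ = 1 + ((f a).ncard + ∑ i ∈ s, (f i).ncard) := by ring

/-- **HY21's halving step, summed over the half-row-sets actually met (row-set entropy).**  For a
column split `C₁` and a pencil `c + t·d`, the uniquely supported permutation sums number at most
`∑_{S ∈ T} (|UM(half sums C₁ → S)| + |UM(half sums C₁ᶜ → Sᶜ)|)` for ANY family `T` of row sets
meeting every uniquely supported point (`ncard_um_permSums_step` of the tree is `T = all`).  Hence
`|UM| ≤ |T| · 2 · (half-size maximum)` and, recursively, `σ(DS_n) ≤ (2Q)^{⌈log₂ n⌉}` when at most `Q`
row sets are met at every scale: a witness of `ShadowBirkhoff` must run its optimal matchings through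
super-quasi-polynomially many distinct row-subsets `π(C₁)` along one pencil at some scale.
[cite: HrubesYehudayoff2021, Prop. 23 (proof), refined] -/
theorem ncard_um_permSums_le_met {R C : Type u} [Fintype R] [Fintype C] [DecidableEq R]
    [DecidableEq C] (w : R → C → G) (C₁ : Finset C) (T : Finset (Finset R))
    (hT : ∀ p ∈ UM[c, d, Set.range (fun e : C ≃ R => ∑ x, w (e x) x)], ∃ S ∈ T,
      p ∈ Set.range (fun e : {x // x ∈ C₁} ≃ {r // r ∈ S} => ∑ x, w (e x) x) +
        Set.range (fun e : {x // x ∉ C₁} ≃ {r // r ∉ S} => ∑ x, w (e x) x)) :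
    (UM[c, d, Set.range (fun e : C ≃ R => ∑ x, w (e x) x)]).ncard ≤
      ∑ S ∈ T, ((UM[c, d, Set.range (fun e : {x // x ∈ C₁} ≃ {r // r ∈ S} => ∑ x, w (e x) x)]).ncard +
        (UM[c, d, Set.range (fun e : {x // x ∉ C₁} ≃ {r // r ∉ S} => ∑ x, w (e x) x)]).ncard) := by
  classical
  set X : Finset R → Set G := fun S =>
    Set.range (fun e : {x // x ∈ C₁} ≃ {r // r ∈ S} => ∑ x, w (e x) x) +
      Set.range (fun e : {x // x ∉ C₁} ≃ {r // r ∉ S} => ∑ x, w (e x) x) with hX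
  have hU : Set.range (fun e : C ≃ R => ∑ x, w (e x) x) = ⋃ S, X S :=
    HrubesYehudayoff2021Prop23.permSums_eq_iUnion w C₁
  have hXfin : ∀ S, (X S).Finite := fun S => (Set.finite_range _).add (Set.finite_range _)
  have hsub : UM[c, d, Set.range (fun e : C ≃ R => ∑ x, w (e x) x)] ⊆
      ⋃ S : {S // S ∈ T}, UM[c, d, X S.1] := by
    rintro p hp
    obtain ⟨S, hST, hpS⟩ := hT p hp
    obtain ⟨-, t, ht⟩ := hp
    refine Set.mem_iUnion.2 ⟨⟨S, hST⟩, hpS, t, fun q hq hne => ht q ?_ hne⟩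
    rw [hU]
    exact Set.mem_iUnion.2 ⟨S, hq⟩
  calc (UM[c, d, Set.range (fun e : C ≃ R => ∑ x, w (e x) x)]).ncard
      ≤ (⋃ S : {S // S ∈ T}, UM[c, d, X S.1]).ncard :=
        Set.ncard_le_ncard hsub (Set.finite_iUnion fun S => (hXfin S.1).subset fun p hp => hp.1)
    _ ≤ ∑ S : {S // S ∈ T}, (UM[c, d, X S.1]).ncard := Set.ncard_iUnion_le_of_fintype _
    _ = ∑ S ∈ T, (UM[c, d, X S]).ncard := Finset.sum_coe_sort T fun S => (UM[c, d, X S]).ncard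
    _ ≤ _ := Finset.sum_le_sum fun S _ =>
        HrubesYehudayoff2021Prop23.ncard_um_add_le c d _ _ (Set.finite_range _) (Set.finite_range _)

end Pencil

/-! ## The plane: vertices versus pencils and coordinate values -/

section Plane

local notation3 (prettyPrint := false) "UM[" c ", " d ", " X "]" =>
  {p | p ∈ X ∧ ∃ t : ℝ, ∀ q ∈ X, q ≠ p → c q + t * d q < c p + t * d p}

/-- If every one of the four pencils `±x₀ + t x₁`, `±x₁ + t x₀` supports uniquely at most `B`
points of the finite planar set `S`, then `conv S` has at most `4B` vertices. [folklore] -/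
theorem ncard_extremePoints_le_of_pencils (S : Set (Fin 2 → ℝ)) (hS : S.Finite) (B : ℕ)
    (hB : ∀ c d : (Fin 2 → ℝ) →+ ℝ, (UM[c, d, S]).ncard ≤ B) :
    (Set.extremePoints ℝ (convexHull ℝ S)).ncard ≤ 4 * B := by
  have h4 := HrubesYehudayoff2021Prop23.extremePoints_subset_um4
    (Pi.evalAddMonoidHom (fun _ => ℝ) 0) (Pi.evalAddMonoidHom (fun _ => ℝ) 1) (fun _ => rfl)
    (fun _ => rfl) S hS
  have hf : ∀ c d : (Fin 2 → ℝ) →+ ℝ, (UM[c, d, S]).Finite := fun c d => hS.subset fun p hp => hp.1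
  refine (Set.ncard_le_ncard h4 ((((hf _ _).union (hf _ _)).union (hf _ _)).union (hf _ _))).trans ?_
  have u1 := Set.ncard_union_le
    (UM[(Pi.evalAddMonoidHom (fun _ => ℝ) 0), (Pi.evalAddMonoidHom (fun _ => ℝ) 1), S] ∪
      UM[(-(Pi.evalAddMonoidHom (fun _ => ℝ) 0)), (Pi.evalAddMonoidHom (fun _ => ℝ) 1), S] ∪
      UM[(Pi.evalAddMonoidHom (fun _ => ℝ) 1), (Pi.evalAddMonoidHom (fun _ => ℝ) 0), S])
    UM[(-(Pi.evalAddMonoidHom (fun _ => ℝ) 1)), (Pi.evalAddMonoidHom (fun _ => ℝ) 0), S]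
  have u2 := Set.ncard_union_le
    (UM[(Pi.evalAddMonoidHom (fun _ => ℝ) 0), (Pi.evalAddMonoidHom (fun _ => ℝ) 1), S] ∪
      UM[(-(Pi.evalAddMonoidHom (fun _ => ℝ) 0)), (Pi.evalAddMonoidHom (fun _ => ℝ) 1), S])
    UM[(Pi.evalAddMonoidHom (fun _ => ℝ) 1), (Pi.evalAddMonoidHom (fun _ => ℝ) 0), S]
  have u3 := Set.ncard_union_le
    UM[(Pi.evalAddMonoidHom (fun _ => ℝ) 0), (Pi.evalAddMonoidHom (fun _ => ℝ) 1), S]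
    UM[(-(Pi.evalAddMonoidHom (fun _ => ℝ) 0)), (Pi.evalAddMonoidHom (fun _ => ℝ) 1), S]
  have b1 := hB (Pi.evalAddMonoidHom (fun _ => ℝ) 0) (Pi.evalAddMonoidHom (fun _ => ℝ) 1)
  have b2 := hB (-(Pi.evalAddMonoidHom (fun _ => ℝ) 0)) (Pi.evalAddMonoidHom (fun _ => ℝ) 1)
  have b3 := hB (Pi.evalAddMonoidHom (fun _ => ℝ) 1) (Pi.evalAddMonoidHom (fun _ => ℝ) 0)
  have b4 := hB (-(Pi.evalAddMonoidHom (fun _ => ℝ) 1)) (Pi.evalAddMonoidHom (fun _ => ℝ) 0)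
  omega

/-- **Vertices vs. values.** A polygon spanned by a finite planar set `S` has at most
`2·|x₀(S)| + 2·|x₁(S)|` vertices (each of the four pencils `±x₀ + t x₁`, `±x₁ + t x₀` supports
uniquely at most as many points as its second functional has values). [folklore] -/
theorem ncard_extremePoints_le_two_mul_values (S : Set (Fin 2 → ℝ)) (hS : S.Finite) :
    (Set.extremePoints ℝ (convexHull ℝ S)).ncard ≤
      2 * ((fun p => p 0) '' S).ncard + 2 * ((fun p => p 1) '' S).ncard := by
  have h4 := HrubesYehudayoff2021Prop23.extremePoints_subset_um4
    (Pi.evalAddMonoidHom (fun _ => ℝ) 0) (Pi.evalAddMonoidHom (fun _ => ℝ) 1) (fun _ => rfl)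
    (fun _ => rfl) S hS
  have hf : ∀ c d : (Fin 2 → ℝ) →+ ℝ, (UM[c, d, S]).Finite := fun c d => hS.subset fun p hp => hp.1
  refine (Set.ncard_le_ncard h4 ((((hf _ _).union (hf _ _)).union (hf _ _)).union (hf _ _))).trans ?_
  have u1 := Set.ncard_union_le
    (UM[(Pi.evalAddMonoidHom (fun _ => ℝ) 0), (Pi.evalAddMonoidHom (fun _ => ℝ) 1), S] ∪
      UM[(-(Pi.evalAddMonoidHom (fun _ => ℝ) 0)), (Pi.evalAddMonoidHom (fun _ => ℝ) 1), S] ∪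
      UM[(Pi.evalAddMonoidHom (fun _ => ℝ) 1), (Pi.evalAddMonoidHom (fun _ => ℝ) 0), S])
    UM[(-(Pi.evalAddMonoidHom (fun _ => ℝ) 1)), (Pi.evalAddMonoidHom (fun _ => ℝ) 0), S]
  have u2 := Set.ncard_union_le
    (UM[(Pi.evalAddMonoidHom (fun _ => ℝ) 0), (Pi.evalAddMonoidHom (fun _ => ℝ) 1), S] ∪
      UM[(-(Pi.evalAddMonoidHom (fun _ => ℝ) 0)), (Pi.evalAddMonoidHom (fun _ => ℝ) 1), S])
    UM[(Pi.evalAddMonoidHom (fun _ => ℝ) 1), (Pi.evalAddMonoidHom (fun _ => ℝ) 0), S]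
  have u3 := Set.ncard_union_le
    UM[(Pi.evalAddMonoidHom (fun _ => ℝ) 0), (Pi.evalAddMonoidHom (fun _ => ℝ) 1), S]
    UM[(-(Pi.evalAddMonoidHom (fun _ => ℝ) 0)), (Pi.evalAddMonoidHom (fun _ => ℝ) 1), S]
  have b1 := ncard_um_le_ncard_image (Pi.evalAddMonoidHom (fun _ => ℝ) 0)
    (Pi.evalAddMonoidHom (fun _ => ℝ) 1) S hS
  have b2 := ncard_um_le_ncard_image (-(Pi.evalAddMonoidHom (fun _ => ℝ) 0))
    (Pi.evalAddMonoidHom (fun _ => ℝ) 1) S hS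
  have b3 := ncard_um_le_ncard_image (Pi.evalAddMonoidHom (fun _ => ℝ) 1)
    (Pi.evalAddMonoidHom (fun _ => ℝ) 0) S hS
  have b4 := ncard_um_le_ncard_image (-(Pi.evalAddMonoidHom (fun _ => ℝ) 1))
    (Pi.evalAddMonoidHom (fun _ => ℝ) 0) S hS
  have e0 : ((Pi.evalAddMonoidHom (fun _ => ℝ) 0 : (Fin 2 → ℝ) →+ ℝ) : (Fin 2 → ℝ) → ℝ) '' S =
      (fun p => p 0) '' S := rfl
  have e1 : ((Pi.evalAddMonoidHom (fun _ => ℝ) 1 : (Fin 2 → ℝ) →+ ℝ) : (Fin 2 → ℝ) → ℝ) '' S =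
      (fun p => p 1) '' S := rfl
  rw [e1] at b1 b2
  rw [e0] at b3 b4
  omega

end Plane

/-- Specialisation to the Birkhoff shadow: `|vert L(DS_n)| ≤ 2·V₀ + 2·V₁`, `V_i` the number of
values of the `i`-th coordinate of `L` on permutation matrices. [folklore] -/
theorem birkhoffShadowVertexCount_le_values {n : ℕ} (L : (Fin n × Fin n → ℝ) →ₗ[ℝ] (Fin 2 → ℝ)) :
    birkhoffShadowVertexCount L ≤
      2 * ((fun p => p 0) '' (L '' permMatrixPoints n)).ncard +
        2 * ((fun p => p 1) '' (L '' permMatrixPoints n)).ncard := by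
  have hfin : (L '' permMatrixPoints n).Finite := by
    rw [HrubesYehudayoff2021Prop23.image_permMatrixPoints_eq_range]; exact Set.finite_range _
  exact ncard_extremePoints_le_two_mul_values _ hfin

end Summit.ValiantsHypothesis.Theorems.ShadowBirkhoffNegative

end
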